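import Mathlib
import HarnessLib
import Summits.HodgeConjecture.HodgeConjecture.Theses.HeckePrymWeil
import Literature.AlgebraicGeometry.Motives.AbelianVarietyProduct

/-!
# Crux-ideate sketch (ideator 1, round 1) for `WeilVariationalHodge` (stmt-HodgeConjecture-14497)

First lemmas of the idea cards `conjugate-doubling-semihomogeneous-design` and
`weil-character-torsion`, stated over existing declarations (no proofs; they must elaborate).
-/

namespace Summit.HodgeConjecture.HodgeConjecture.Cruxes.WeilVariationalHodge.IdeatorOne

open CategoryTheory
open Literature.AlgebraicGeometry.Motives Literature.AlgebraicGeometry.HodgeTheory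

noncomputable section

/-- The complexified Weil span of `(X, ψ)` (with `ψ ≫ ψ = -p`) in degree `N`: the two eigenspaces of
`(𝟙 + ψ)^*` for the eigenvalues `(1 ± i√p)^N` (same typing as the route `HeckePrymWeil`). -/
def weilSpan (X : AbelianVariety ℂ) (ψ : X ⟶ X) (p N : ℕ) : Submodule ℂ (complexBetti X.X N) :=
  Module.End.eigenspace (complexBetti.map (𝟙 X + ψ).hom.hom.hom N).hom
      ((1 + Complex.I * (Real.sqrt (p : ℝ) : ℂ)) ^ N) ⊔
    Module.End.eigenspace (complexBetti.map (𝟙 X + ψ).hom.hom.hom N).hom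
      ((1 - Complex.I * (Real.sqrt (p : ℝ) : ℂ)) ^ N)

/-- `WeilAlg X ψ p m`: every rational `(m,m)`-class in the Weil span of `(X, ψ)` (intended:
`dim X = 2m`, `ψ ≫ ψ = -p`) is algebraic — the rung predicate of the route, for the pair `(X, ψ)`. -/
def WeilAlg (X : AbelianVariety ℂ) (ψ : X ⟶ X) (p m : ℕ) : Prop :=
  ∀ c : complexBetti X.X (2 * m), IsRationalClass c → IsOfHodgeType (2 * m) X.X (2 * m) m m c →
    c ∈ weilSpan X ψ p (2 * m) → c ∈ algebraicClasses X.X m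

/-- **First lemma of `conjugate-doubling-semihomogeneous-design` (the diagonal anchor is free).**
For every abelian `2M`-fold `A` with `φ ≫ φ = -p`, the Weil classes of the CONJUGATE DOUBLE
`(A × A, φ × (-φ))` (Weil type of signature `(2M,2M)`, discriminant `1`) are algebraic: they are
invariant under the diagonal unitary group `U(H¹(A,ℚ), H)`, hence polynomials in the four divisor
classes `θ₁, θ₂, ℓ, ℓ_φ` of `A × A` (first fundamental theorem for `GL_{2M}`); equivalently
`(A × A, φ × (-φ))` is `K`-isogenous to `A ⊗_ℤ O_K` (`SiegelAnchor`). -/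
def ConjugateDoublingAnchor : Prop :=
  ∀ p : ℕ, p.Prime → p % 4 = 3 → 7 ≤ p → ∀ M : ℕ, 1 ≤ M →
    ∀ (A : AbelianVariety ℂ) (φ : A ⟶ A), A.dim = 2 * M →
      φ ≫ φ = -((p : ℤ) • 𝟙 A) →
      WeilAlg (A.prod A)
        (AbelianVariety.prodLift (AbelianVariety.fst A A ≫ φ) (AbelianVariety.snd A A ≫ (-φ))) p (2 * M)

/-- **Siegel anchors** (`B ⊗_ℤ O_K`): for EVERY complex abelian `g`-fold `B`, the pair
`(B × B, J)` with `J(x,y) = (-p·y, x)` (`J ≫ J = -p`) is of Weil type `(g,g)` and its Weil classes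
are algebraic: the Weil class is the value at `t = i√p` of the graph-class polynomial
`t ↦ [Γ_t] = Σ tᵏ πₖ` (`πₖ` = Künneth components of `Δ_B`, `Sp(H₁(B))`-invariant, hence polynomials
in `θ₁, θ₂, ℓ`). -/
def SiegelAnchor : Prop :=
  ∀ p : ℕ, p.Prime → p % 4 = 3 → 7 ≤ p → ∀ g : ℕ, 1 ≤ g →
    ∀ (B : AbelianVariety ℂ), B.dim = g →
      WeilAlg (B.prod B)
        (AbelianVariety.prodLift (AbelianVariety.snd B B ≫ (-((p : ℤ) • 𝟙 B))) (AbelianVariety.fst B B)) p g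

/-- **First lemma of `weil-character-torsion` (quaternionic half-anchor).** If `(A, φ)` is
`K`-skew-isogenous to itself — some isogeny `j` with `j ≫ φ = -(φ ≫ j)`, e.g. `K ⊂ D ⊂ End⁰(A)` for a
quaternion algebra `D` — then the CHARGE-TWO Weil classes, i.e. the Weil classes of
`(A × A, φ × φ)` (discriminant `d²`, split component), are algebraic: pull back the free class of
`ConjugateDoublingAnchor` along `1 × j`. In Tannakian terms the Weil character `χ_A` of the
motivic Galois group satisfies `χ_A² = 1`. -/
def QuaternionicChargeTwo : Prop :=
  ∀ p : ℕ, p.Prime → p % 4 = 3 → 7 ≤ p → ∀ M : ℕ, 1 ≤ M →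
    ∀ (A : AbelianVariety ℂ) (φ : A ⟶ A), A.dim = 2 * M →
      φ ≫ φ = -((p : ℤ) • 𝟙 A) →
      (∃ j : A ⟶ A, AbelianVariety.IsIsogeny j ∧ j ≫ φ = -(φ ≫ j)) →
      WeilAlg (A.prod A)
        (AbelianVariety.prodLift (AbelianVariety.fst A A ≫ φ) (AbelianVariety.snd A A ≫ φ)) p (2 * M)

/-- **Coprime charges** (pure Tannakian bookkeeping, stated for charges 1·a - 1·b): if the Weil
classes of `(A, φ)` powers with two coprime charges are algebraic then so are those of `(A, φ)`.
Here the minimal instance: charge 2 on `(A × A, φ × φ)` and charge 3 on `(A × A × A, φ × φ × φ)`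
give charge 1. -/
def CoprimeCharges : Prop :=
  ∀ p : ℕ, p.Prime → p % 4 = 3 → 7 ≤ p → ∀ M : ℕ, 1 ≤ M →
    ∀ (A : AbelianVariety ℂ) (φ : A ⟶ A), A.dim = 2 * M →
      φ ≫ φ = -((p : ℤ) • 𝟙 A) →
      WeilAlg (A.prod A)
        (AbelianVariety.prodLift (AbelianVariety.fst A A ≫ φ) (AbelianVariety.snd A A ≫ φ)) p (2 * M) →
      WeilAlg ((A.prod A).prod A)
        (AbelianVariety.prodLift
          (AbelianVariety.fst (A.prod A) A ≫
            AbelianVariety.prodLift (AbelianVariety.fst A A ≫ φ) (AbelianVariety.snd A A ≫ φ))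
          (AbelianVariety.snd (A.prod A) A ≫ φ)) p (3 * M) →
      WeilAlg A φ p M

/-- **Local transport suffices** (support, provable now): an equivalence relation on a preconnected
space all of whose classes are neighbourhoods of their points is trivial. Used with
`R s s' :⇔ "the exterior transport class Ξ_{s,s'} = W_s ⊠ W̄_{s'} + c.c. is algebraic on
A_s × A_{s'}"`, which is an equivalence relation containing the diagonal by
`ConjugateDoublingAnchor`. -/
def LocalTransportSuffices : Prop :=
  ∀ (S : Type) [TopologicalSpace S] [PreconnectedSpace S] (R : S → S → Prop),
    Equivalence R → (∀ s : S, ∀ᶠ t in nhds s, R s t) → ∀ s t : S, R s t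

theorem localTransportSuffices : LocalTransportSuffices := by
  intro S _ _ R hR hloc s t
  classical
  -- the class of `s` is clopen
  let U : Set S := {x | R s x}
  have hUopen : IsOpen U := by
    rw [isOpen_iff_mem_nhds]
    intro x hx
    filter_upwards [hloc x] with y hy using hR.trans hx hy
  have hUclosed : IsClosed U := by
    rw [← isOpen_compl_iff, isOpen_iff_mem_nhds]
    intro x hx
    filter_upwards [hloc x] with y hy
    intro hsy
    exact hx (hR.trans hsy (hR.symm hy))
  have hUuniv : U = Set.univ := by
    rcases isClopen_iff.mp ⟨hUclosed, hUopen⟩ with h | h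
    · exact absurd (show s ∈ U from hR.refl s) (by simp [h])
    · exact h
  have : t ∈ U := by simp [hUuniv]
  exact this

end

end Summit.HodgeConjecture.HodgeConjecture.Cruxes.WeilVariationalHodge.IdeatorOne
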